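import Summits.AnomalousDissipation.AnomalousDissipation.Theorems.WindLineWindyGalerkinSteadyZerothLawNondegenerateLoudOpenTools
import Summits.AnomalousDissipation.AnomalousDissipation.Theorems.WindLineWindyGalerkinSteadyZerothLawLinearisationInjective

/-!
# Persistence of leaf-nondegenerate steady states under force perturbation, WITH nondegeneracy
# of the persisted state (stub `stub_nondegenerateLoudOpen`, crux `WindLine.WindyGalerkinSteadyZerothLaw`,
# stmt-AnomalousDissipation-11414, line `registered`)

The steady implicit-function theorem at fixed viscosity in a conserved-momentum leaf
(Temam 1979 Ch. II §1 Thm. 1.3; Foias–Temam 1977 §1; Saut–Temam 1980 §2), for GENERAL smooth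
divergence-free mean-zero forces measured by the `ℓ²` distance of their Fourier families
(`= L²` distance), and with the extra conclusion that the persisted state is again
leaf-nondegenerate: adapted from `Literature.Analysis.FluidPDE.SteadyLatticeDrift.steadyPersistsInLeaf_of_nondeg`
(§5 there = the landed `stub_linearisationInjective`; the new §7b: the persisted lattice point
stays in the ball where `4π²ν + D + K_x` is injective, `loudOpen_injective_near`, and a
classical eigenvector of `L(ν,u')` at `0` would be a non-zero lattice kernel vector,
`loudOpen_exists_kernel_of_isLinNSEigenvalue`).  The theorem is the registered helper
sub-goal `loudOpen_steadyPersistsNondeg` of stub `stub_nondegenerateLoudOpen`.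
-/

noncomputable section

-- D-0017: single-problem summit ⇒ the duplicated namespace segment is by design.
set_option linter.dupNamespace false

open scoped InnerProductSpace Topology ComplexConjugate
open MeasureTheory Filter UnitAddTorus
open Literature.Analysis.FunctionSpaces Literature.Analysis.FunctionSpaces.Torus
open Literature.Analysis.FunctionSpaces.EuclideanSpace
open Literature.Analysis.FluidPDE Literature.Analysis.FluidPDE.Torus
open Literature.Analysis.FluidPDE.ScalarFourier
open Literature.Analysis.FluidPDE.SteadyLattice Literature.Analysis.FluidPDE.SteadyLatticeDrift

namespace Summit.AnomalousDissipation.AnomalousDissipation.Theorems.WindLineWindyGalerkinSteadyZerothLaw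

/-- The flat three-torus (local notation). -/
local notation "𝕋³" => UnitAddTorus (Fin 3)
/-- Velocity values (local notation). -/
local notation "E³" => EuclideanSpace ℝ (Fin 3)
/-- Complex coefficient vectors (local notation). -/
local notation "ℂ³" => EuclideanSpace ℂ (Fin 3)
/-- Square-summable coefficient families `ℤ³ → ℂ³` (local notation). -/
local notation "ℓ2" => lp (fun _ : Fin 3 → ℤ => EuclideanSpace ℂ (Fin 3)) 2
/-- Physical coefficients `x̌(k) = x(k)/|k|²` of a family (local notation, the tree's `cf`). -/
local notation "cf[" X "]" => ((fun mm : Fin 3 → ℤ => (((freqNormSq mm)⁻¹ : ℝ) : ℂ)) • (X : (Fin 3 → ℤ) → EuclideanSpace ℂ (Fin 3)))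
/-- `k · v = ∑ⱼ kⱼ vⱼ` (local notation, the tree's `kdot`). -/
local notation "kdot[" k "," v "]" => (∑ jj : Fin 3, (((k : Fin 3 → ℤ) jj : ℤ) : ℂ) * (v : EuclideanSpace ℂ (Fin 3)) jj)
/-- The convective symbol `N(a, b)(k)` as a vector of `ℂ³` (local notation, the tree's `nl`). -/
local notation "nl[" a "," b "," k "]" =>
  ((WithLp.toLp 2 (fun pp : Fin 3 => transportSym (fun jj mm => (a : (Fin 3 → ℤ) → EuclideanSpace ℂ (Fin 3)) mm jj)
    (fun mm => (b : (Fin 3 → ℤ) → EuclideanSpace ℂ (Fin 3)) mm pp) k)) : EuclideanSpace ℂ (Fin 3))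

set_option maxHeartbeats 1600000 in
-- adapted from Literature/Analysis/FluidPDE/SteadyNSLatticePersistenceDrift.lean (`steadyPersistsInLeaf_of_nondeg`)
/-- **Steady implicit-function theorem in a conserved-momentum leaf, with nondegeneracy of the
persisted state.**  Let `u₀` be a classical steady state of `NS_ν(f₀)`, `ν > 0`, `f₀` smooth,
divergence free and mean zero, of arbitrary mean, leaf-nondegenerate (`¬ IsLinNSEigenvalue ν u₀ 0`).
For every `δ > 0` there is `r > 0` such that every smooth divergence-free mean-zero force `f` with
`∑_k ‖f̂(k) − f̂₀(k)‖² < r²` carries a classical steady state `u'` of `NS_ν(f)` with the SAME mean,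
again leaf-nondegenerate, and `∫|u' − u₀|² + ‖∇(u' − u₀)‖² < δ`.  Proof: base point
`x₀ = (|k|² û₀(k))_{k≠0} ∈ W`, steady map `G(x) = 4π²ν x + D x + B(x,x)`, `DG(x₀) = 4π²ν + (D + K)`
injective (`stub_linearisationInjective`) hence a linear homeomorphism (Fredholm,
`exists_equiv_of_injective`); local inversion (`local_solve`) inside the ball where
`4π²ν + D + K_x` stays injective (`loudOpen_injective_near`); the solution is rapidly decaying
(`rapidDecay_of_perturbed_eq`), synthesises a classical steady state of the same mean
(`steadyState_of_fourier'`), is nondegenerate (`loudOpen_exists_kernel_of_isLinNSEigenvalue`), and is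
`H¹`-close by Parseval (`h1_le_of_coeff`). -/
theorem loudOpen_steadyPersistsNondeg :
    ∀ (ν : ℝ) (f₀ u₀ : UnitAddTorus (Fin 3) → EuclideanSpace ℝ (Fin 3)) (p₀ : UnitAddTorus (Fin 3) → ℝ),
      0 < ν → IsSmooth f₀ → IsDivFree f₀ → HasZeroMean f₀ → IsSteadyNSState ν f₀ u₀ p₀ →
      ¬ IsLinNSEigenvalue ν u₀ 0 → ∀ δ : ℝ, 0 < δ → ∃ r : ℝ, 0 < r ∧
        ∀ f : UnitAddTorus (Fin 3) → EuclideanSpace ℝ (Fin 3), IsSmooth f → IsDivFree f → HasZeroMean f →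
          (∑' k, ‖mFourierCoeff (EuclideanSpace.complexify ∘ f) k -
            mFourierCoeff (EuclideanSpace.complexify ∘ f₀) k‖ ^ 2) < r ^ 2 →
          ∃ (u' : UnitAddTorus (Fin 3) → EuclideanSpace ℝ (Fin 3)) (p' : UnitAddTorus (Fin 3) → ℝ),
            IsSteadyNSState ν f u' p' ∧ (∫ x, u' x) = (∫ x, u₀ x) ∧ ¬ IsLinNSEigenvalue ν u' 0 ∧
              (∫ x, ‖u' x - u₀ x‖ ^ 2) + gradNormSq (fun x => u' x - u₀ x) < δ := by
  intro ν f₀ u₀ p₀ hν hf₀ hf₀d hf₀m hst hnd δ hδ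
  -- §1 the unperturbed state on the Fourier side (full family, zero mode = the mean)
  have hu₀ : IsSmooth u₀ := hst.smooth_velocity.isSmooth_slice (Set.mem_univ 0)
  have hdiv₀ : IsDivFree u₀ := hst.divFree 0 (Set.mem_univ 0)
  set a : (Fin 3 → ℤ) → ℂ³ := mFourierCoeff (complexify ∘ u₀) with ha
  have har : RapidDecay a := hu₀.complexify_comp.rapidDecay_mFourierCoeff
  have hat : ∀ m : Fin 3 → ℤ, kdot[m, a m] = 0 := fun m => hdiv₀.sum_mul_mFourierCoeff_eq_zero hu₀ m
  have hacs : IsConjSymm a := isConjSymm_mFourierCoeff hu₀.integrable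
  have hM : conjVec (a 0) = a 0 := by
    have h := hacs 0
    rw [neg_zero] at h
    exact h.symm
  have hbr : RapidDecay (Function.update a 0 0) := rapidDecay_update har
  have heq₀ : ∀ k : Fin 3 → ℤ, (((ν * (4 * Real.pi ^ 2 * freqNormSq k)) : ℝ) : ℂ) • a k +
      lerayCoeff k nl[a, a, k] = mFourierCoeff (complexify ∘ f₀) k := fun k => by
    rw [ha, fourier_eq_of_isSteadyNSState' hst hf₀ k, loudOpen_lerayCoeff_mFourierCoeff hf₀ hf₀d hf₀m]
  -- §2 the state space, the bilinear map, the drift, the force point of `f₀`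
  obtain ⟨W, hW, hWc⟩ := exists_space
  haveI : CompleteSpace W := completeSpace_W hWc
  obtain ⟨B, hB, hBb⟩ := exists_bilinear hW
  obtain ⟨D, hD, hDc⟩ := exists_drift hW hWc hM
  obtain ⟨y₀, hy₀⟩ := loudOpen_exists_forcePoint W hW hf₀ hf₀d hf₀m
  -- §3 the base point `x₀` (its physical coefficients are the punctured family `a°`)
  set X₀ : (Fin 3 → ℤ) → ℂ³ := fun k => ((freqNormSq k : ℝ) : ℂ) • a k with hX₀
  have hX₀r : RapidDecay X₀ := by
    refine har.of_norm_le_mul_pow (C := 1) (s := 1) fun k => ?_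
    rw [hX₀]
    dsimp only
    rw [norm_smul, Complex.norm_real, Real.norm_of_nonneg (freqNormSq_nonneg k), one_mul, pow_one]
    exact mul_le_mul_of_nonneg_right (by linarith [freqNormSq_nonneg k]) (norm_nonneg _)
  have hX00 : X₀ 0 = 0 := by simp [hX₀, freqNormSq_zero]
  have hX₀V : ((X₀ : (Fin 3 → ℤ) → ℂ³) 0 = 0 ∧ (∀ kk : Fin 3 → ℤ, kdot[kk, (X₀ : (Fin 3 → ℤ) → ℂ³) kk] = 0) ∧
      IsConjSymm (X₀ : (Fin 3 → ℤ) → ℂ³)) := by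
    refine ⟨hX00, fun k => by rw [hX₀]; dsimp only; rw [kdot_smul, hat k, mul_zero], fun k => ?_⟩
    rw [hX₀]
    dsimp only
    rw [freqNormSq_neg, hacs k, conjVec_smul, Complex.conj_ofReal]
  set x₀ : W := ⟨⟨X₀, memℓp_two_of_rapidDecay hX₀r⟩, (hW _).2 hX₀V⟩ with hx₀def
  have hx₀ : ((x₀ : ℓ2) : (Fin 3 → ℤ) → ℂ³) = X₀ := rfl
  have hcfX : cf[X₀] = Function.update a 0 0 := by rw [hX₀]; exact cf_weight_smul' a
  have hcf : cf[((x₀ : ℓ2) : (Fin 3 → ℤ) → ℂ³)] = Function.update a 0 0 := by rw [hx₀]; exact hcfX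
  -- §4 the drifted steady map and its derivative
  set cν : ℝ := 4 * Real.pi ^ 2 * ν with hcν
  have hcν0 : cν ≠ 0 := by positivity
  set G : W → W := fun x => cν • x + D x + B x x with hG
  set K : W →L[ℝ] W := (hBb.deriv (x₀, x₀)).comp ((ContinuousLinearMap.id ℝ W).prod (ContinuousLinearMap.id ℝ W))
    with hK
  have hKw : ∀ w, K w = B x₀ w + B w x₀ := fun w => by simp [hK, IsBoundedBilinearMap.deriv_apply]
  have hGd : HasStrictFDerivAt G (cν • ContinuousLinearMap.id ℝ W + (D + K)) x₀ := by
    have h := (hasStrictFDerivAt_steadyMap hBb cν x₀).add (D.hasStrictFDerivAt (x := x₀))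
    have e : G = fun x => (cν • x + B x x) + D x := by
      funext x
      simp only [hG]
      abel
    rw [e]
    refine h.congr_fderiv ?_
    rw [hK]
    abel
  have hKc : IsCompactOperator K := isCompactOperator_linearised hWc hB x₀ (by rw [hcf]; exact hbr) K hKw
  have hDKc : IsCompactOperator (D + K) := hDc.add hKc
  -- coordinates of `G`
  have hGcoe : ∀ x : W, (((G x : W) : ℓ2) : (Fin 3 → ℤ) → ℂ³) = fun k =>
      ((cν : ℝ) : ℂ) • ((x : ℓ2) : (Fin 3 → ℤ) → ℂ³) k +
      (2 * Real.pi * Complex.I * kdot[k, a 0]) • cf[((x : ℓ2) : (Fin 3 → ℤ) → ℂ³)] k +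
      lerayCoeff k nl[cf[((x : ℓ2) : (Fin 3 → ℤ) → ℂ³)], cf[((x : ℓ2) : (Fin 3 → ℤ) → ℂ³)], k] := by
    intro x
    rw [hG]
    dsimp only
    rw [coeW_add, coeW_add, coeW_smul, hB, hD]
    funext k
    simp only [Pi.add_apply, Pi.smul_apply, Complex.coe_smul]
  -- §5 injectivity of the linearisation (the landed `stub_linearisationInjective`)
  have hinj : ∀ w : W, cν • w + (D + K) w = 0 → w = 0 :=
    stub_linearisationInjective W hW B hB ν u₀ D K x₀ hν hu₀ hdiv₀ hnd hD hKw hcf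
  -- §6 the derivative is an isomorphism; injectivity nearby; local inversion
  obtain ⟨L, hL⟩ := exists_equiv_of_injective hDKc hcν0 hinj
  have hLeq : (L : W →L[ℝ] W) = cν • ContinuousLinearMap.id ℝ W + (D + K) := by
    ext w
    simp [hL w]
  have hGd' : HasStrictFDerivAt G (L : W →L[ℝ] W) x₀ := by rw [hLeq]; exact hGd
  have hGx₀ : G x₀ = y₀ := by
    refine Subtype.ext (lp.ext (funext fun k => ?_))
    rw [hGcoe, hy₀]
    dsimp only
    rw [hx₀, smul_eq_weight_smul_cf hX00 k, hcfX, ← heq₀ k, leray_nl_self_update har hat k, weight_smul_update]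
    abel
  obtain ⟨ρ, hρ, hρinj⟩ := loudOpen_injective_near hBb (cν • ContinuousLinearMap.id ℝ W + D) L x₀ fun w => by
    rw [hL w, ← hKw w]
    simp only [add_apply, smul_apply, ContinuousLinearMap.id_apply]
    abel
  -- radii
  set δ' : ℝ := min (min 1 (δ / (2 * (1 + 4 * Real.pi ^ 2)))) ρ with hδ'
  have hδ'0 : 0 < δ' := lt_min (lt_min one_pos (by positivity)) hρ
  have hδ'1 : δ' ≤ 1 := (min_le_left _ _).trans (min_le_left _ _)
  have hδ'2 : δ' ≤ δ / (2 * (1 + 4 * Real.pi ^ 2)) := (min_le_left _ _).trans (min_le_right _ _)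
  have hδ'3 : δ' ≤ ρ := min_le_right _ _
  obtain ⟨r, hr, hsolve⟩ := local_solve hGd' hδ'0
  refine ⟨r, hr, fun f hf hfd hfm hff => ?_⟩
  obtain ⟨y, hy⟩ := loudOpen_exists_forcePoint W hW hf hfd hfm
  have hyd : dist y (G x₀) < r := by
    rw [hGx₀, dist_eq_norm]
    refine lt_of_pow_lt_pow_left₀ 2 hr.le ?_
    rw [loudOpen_norm_sub_sq_eq_tsum, hy, hy₀]
    exact hff
  obtain ⟨x, hGx, hdist⟩ := hsolve y hyd
  -- §7 the perturbed solution is a classical steady state with the same mean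
  have hxeq : ∀ k : Fin 3 → ℤ, ((cν : ℝ) : ℂ) • ((x : ℓ2) : (Fin 3 → ℤ) → ℂ³) k +
      (2 * Real.pi * Complex.I * kdot[k, a 0]) • cf[((x : ℓ2) : (Fin 3 → ℤ) → ℂ³)] k +
      lerayCoeff k nl[cf[((x : ℓ2) : (Fin 3 → ℤ) → ℂ³)], cf[((x : ℓ2) : (Fin 3 → ℤ) → ℂ³)], k] =
      mFourierCoeff (complexify ∘ f) k := by
    intro k
    have h := congrArg (fun z : W => (((z : W) : ℓ2) : (Fin 3 → ℤ) → ℂ³) k) hGx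
    dsimp only at h
    rw [hGcoe, hy] at h
    exact h
  have hxr : RapidDecay cf[((x : ℓ2) : (Fin 3 → ℤ) → ℂ³)] :=
    rapidDecay_of_perturbed_eq hν (rapidDecay_single (a 0)) (single_transversal (a 0)) (x : ℓ2) (W_trans hW x)
      (fun s => tsum_weight_mul_enorm_ne_top_of_rapidDecay hf.complexify_comp.rapidDecay_mFourierCoeff s)
      (fun k => by
        rw [leray_nl_linearised_single (a 0) (W_trans hW x) k, ← hcν]
        exact hxeq k)
  -- the full family of the perturbed state: zero mode restored
  set c₁ : (Fin 3 → ℤ) → ℂ³ := cf[((x : ℓ2) : (Fin 3 → ℤ) → ℂ³)] +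
    (Pi.single (0 : Fin 3 → ℤ) (a 0) : (Fin 3 → ℤ) → ℂ³) with hc₁
  have hc₁r : RapidDecay c₁ := hxr.add (rapidDecay_single _)
  have hc₁cs : IsConjSymm c₁ := (isConjSymm_cf (W_conj hW x)).add (isConjSymm_single hM)
  have hc₁t : ∀ k : Fin 3 → ℤ, kdot[k, c₁ k] = 0 := fun k => by
    rw [hc₁, Pi.add_apply, kdot_add, cf_transversal (W_trans hW x) k, single_transversal, add_zero]
  have hupd : Function.update c₁ 0 0 = cf[((x : ℓ2) : (Fin 3 → ℤ) → ℂ³)] := update_add_single_of_zero (cf_zero _) _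
  have hc₁0 : c₁ 0 = a 0 := add_single_apply_zero (cf_zero _) _
  have heq₁ : ∀ k : Fin 3 → ℤ, (((ν * (4 * Real.pi ^ 2 * freqNormSq k)) : ℝ) : ℂ) • c₁ k +
      lerayCoeff k nl[c₁, c₁, k] = mFourierCoeff (complexify ∘ f) k := by
    intro k
    rw [leray_nl_self_update hc₁r hc₁t k, ← weight_smul_update c₁ k, hupd, hc₁0, ← hxeq k,
      smul_eq_weight_smul_cf (W_zero hW x) k]
    abel
  obtain ⟨u', p', hst', hu', hû'⟩ := steadyState_of_fourier' hf hfd hfm hc₁r hc₁cs hc₁t heq₁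
  refine ⟨u', p', hst', integral_eq_of_mFourierCoeff_zero_eq hu' hu₀ (by rw [hû', hc₁0]), ?_, ?_⟩
  · -- §7b nondegeneracy of the persisted state
    intro hev
    set K' : W →L[ℝ] W := (hBb.deriv (x, x)).comp ((ContinuousLinearMap.id ℝ W).prod (ContinuousLinearMap.id ℝ W))
      with hK'
    have hK'w : ∀ w, K' w = B x w + B w x := fun w => by simp [hK', IsBoundedBilinearMap.deriv_apply]
    have hD' : ∀ z : W, (((D z : W) : ℓ2) : (Fin 3 → ℤ) → ℂ³) = fun k =>
        (2 * Real.pi * Complex.I * kdot[k, mFourierCoeff (complexify ∘ u') 0]) • cf[((z : ℓ2) : (Fin 3 → ℤ) → ℂ³)] k :=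
      fun z => by rw [hû', hc₁0]; exact hD z
    have hcf' : cf[((x : ℓ2) : (Fin 3 → ℤ) → ℂ³)] = Function.update (mFourierCoeff (complexify ∘ u')) 0 0 := by
      rw [hû', hupd]
    obtain ⟨w, hwne, hw0⟩ := loudOpen_exists_kernel_of_isLinNSEigenvalue W hW B hB ν u' D K' x hu' hD' hK'w hcf' hev
    refine hwne (hρinj x ?_ w ?_)
    · rw [← dist_eq_norm]
      exact hdist.trans_le hδ'3
    · rw [← hw0, ← hcν]
      simp only [add_apply, smul_apply, ContinuousLinearMap.id_apply, hK'w]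
      abel
  · -- §8 the `H¹` estimate
    set z : W := x - x₀ with hz
    have hzn : ‖z‖ < δ' := by rwa [hz, ← dist_eq_norm]
    have hv : IsSmooth (fun y => u' y - u₀ y) := hu'.sub hu₀
    have hcoefv : mFourierCoeff (complexify ∘ fun y => u' y - u₀ y) = cf[(((z : W) : ℓ2) : (Fin 3 → ℤ) → ℂ³)] := by
      have e : (complexify ∘ fun y => u' y - u₀ y : 𝕋³ → ℂ³) = (complexify ∘ u') - (complexify ∘ u₀) := by
        funext y; simp
      rw [e, hz, coeW_sub]
      funext k
      rw [mFourierCoeff_sub hu'.complexify_comp.integrable hu₀.complexify_comp.integrable, hû', ← ha]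
      have hak : a k = Function.update a 0 0 k + (Pi.single (0 : Fin 3 → ℤ) (a 0) : (Fin 3 → ℤ) → ℂ³) k :=
        (congrFun (update_add_single a) k).symm
      rw [hak, ← hcf, hc₁]
      simp only [Pi.add_apply, Pi.smul_apply', Pi.sub_apply, smul_sub]
      abel
    have hH := h1_le_of_coeff hv (z : ℓ2) hcoefv
    rw [norm_coeW] at hH
    have hpi : (0 : ℝ) < 1 + 4 * Real.pi ^ 2 := by positivity
    have hz2 : ‖z‖ ^ 2 ≤ δ' * δ' := by
      have := norm_nonneg z
      nlinarith
    have hd : δ' * δ' ≤ δ' := by nlinarith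
    calc (∫ y, ‖u' y - u₀ y‖ ^ 2) + gradNormSq (fun y => u' y - u₀ y) ≤ (1 + 4 * Real.pi ^ 2) * ‖z‖ ^ 2 := hH
      _ ≤ (1 + 4 * Real.pi ^ 2) * δ' := by nlinarith
      _ ≤ (1 + 4 * Real.pi ^ 2) * (δ / (2 * (1 + 4 * Real.pi ^ 2))) := mul_le_mul_of_nonneg_left hδ'2 hpi.le
      _ = δ / 2 := by field_simp
      _ < δ := by linarith

end Summit.AnomalousDissipation.AnomalousDissipation.Theorems.WindLineWindyGalerkinSteadyZerothLaw

end
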